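import Summits.AnomalousDissipation.AnomalousDissipation.Theorems.MarginalStabilityChainStrainedLayerLawClockLine
import Summits.AnomalousDissipation.AnomalousDissipation.Theorems.MarginalStabilityChainStrainedLayerLawStubVorticityUniformBoundsD

/-!
# Stub `stub_negEnstrophyLaw` of line `FirstLemmasR2K4` (log-enstrophy clock; crux `MarginalStabilityChain.StrainedLayerLaw`,
# stmt-AnomalousDissipation-3007) — tools B: the renormalised vorticity balance at one instant

Support file (`--supports stmt-AnomalousDissipation-3007`; registered sub-goal `stub_negEnstrophyLaw_static`). In the
setting of the weak vorticity balance of the stretched layer (tools D of p120637: slice data `u, v ∈ C²`, `p ∈ C¹`,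
time-derivative slices `a = ∂ₜu`, `b = ∂ₜv ∈ C¹` satisfying the momentum equations, `∂ₓu + ∂_yv = 0`, `L`-periodic in
`x`), test against `Φ = F′(ω)ψ(y)` for an arbitrary `C²` function `F` of one variable (`F′ ∈ C¹`, `F″` continuous) and
a `C¹` weight `ψ` vanishing for `|y| ≥ R`:

  `∫∫ F′(ω)ψ (∂ₓb − ∂_ya) = ∫∫ (ωF′(ω) − F(ω))ψ + ∫∫ F(ω)(v − y)ψ′ − ν∫∫ F″(ω)|∇ω|²ψ − ν∫∫ F′(ω)∂_yω ψ′`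

(transport: `ω(u, v − y)·∇Φ = (u, v − y)·∇G(ω) ψ + ωF′(ω)(v − y)ψ′` with `G = sF′ − F`, `G′ = sF″`; integrate by parts
on the period strip and use `∂ₓu + ∂_yv = 0`, i.e. `div(u, v − y) = −1`; viscosity: `∇ω·∇Φ = F″(ω)|∇ω|²ψ + F′(ω)ω_yψ′`).
With `F(s) = s²/2` this is the weighted enstrophy balance of tools G; the line uses it with the regularisation `F_ε`
of `s₋²` (tools A) to obtain the negative-enstrophy law `Ω₋′ = Ω₋ − 2νP₋`. All `[folklore]`.
-/

-- `Summit.<Summit>.<Problem>` is the tree's mandated summit-side namespace (CONVENTIONS §2); for this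
-- single-conjunct summit the two coincide, so the duplicate is deliberate.
set_option linter.dupNamespace false

noncomputable section

open scoped Topology ENNReal
open Filter Set Function MeasureTheory

namespace Summit.AnomalousDissipation.AnomalousDissipation.Theorems.StrainedLayerLaw.LogEnstrophyClock

open Literature.Analysis.FluidPDE Literature.Analysis.FluidPDE.StretchedLayer
open Summit.AnomalousDissipation.AnomalousDissipation.Theses.MarginalStabilityChain
open Summit.AnomalousDissipation.AnomalousDissipation.Theorems.StrainedLayerLaw.StrainWorkSumRule

/-! ## The renormalised vorticity balance at one instant -/

section Static

/-- **The renormalised vorticity balance at one instant (registered sub-goal `stub_negEnstrophyLaw_static`).** In the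
setting of `stub_vorticityUniformBounds_weakVorticity`, test the weak vorticity balance against `Φ = F′(ω)ψ(y)` with
`F ∈ C²(ℝ)` (`F′ ∈ C¹`, `F″` continuous) and `ψ ∈ C¹(ℝ)` vanishing for `|y| ≥ R`:
`∫∫ F′(ω)ψ (∂ₓb − ∂_ya) = ∫∫ (ωF′(ω) − F(ω))ψ + ∫∫ F(ω)(v − y)ψ′ − ν∫∫ F″(ω)|∇ω|²ψ − ν∫∫ F′(ω)∂_yω ψ′`
(transport `ω(u∂ₓΦ + (v − y)∂_yΦ) = (u, v − y)·∇(G(ω)) ψ + ωF′(ω)(v − y)ψ′`, `G = sF′ − F`, integration by parts and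
`∂ₓu + ∂_yv = 0`; viscosity `∇ω·∇Φ = F″(ω)|∇ω|²ψ + F′(ω)∂_yω ψ′`). [folklore] -/
theorem stub_negEnstrophyLaw_static : ∀ (L ν R : ℝ) (u v p a b : ℝ → ℝ → ℝ) (ψ F F' F'' : ℝ → ℝ),
    0 < L →
    ContDiff ℝ 2 (fun q : ℝ × ℝ => u q.1 q.2) → ContDiff ℝ 2 (fun q : ℝ × ℝ => v q.1 q.2) →
    ContDiff ℝ 1 (fun q : ℝ × ℝ => p q.1 q.2) → ContDiff ℝ 1 (fun q : ℝ × ℝ => a q.1 q.2) →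
    ContDiff ℝ 1 (fun q : ℝ × ℝ => b q.1 q.2) →
    (∀ x y, a x y + u x y * dX u x y + (v x y - y) * dY u x y = -dX p x y + ν * lap u x y) →
    (∀ x y, b x y + u x y * dX v x y + (v x y - y) * dY v x y - v x y = -dY p x y + ν * lap v x y) →
    (∀ x y, dX u x y + dY v x y = 0) →
    (∀ x y, u (x + L) y = u x y) → (∀ x y, v (x + L) y = v x y) → (∀ x y, p (x + L) y = p x y) →
    (∀ x y, b (x + L) y = b x y) →
    ContDiff ℝ 1 ψ → (∀ y, R ≤ |y| → ψ y = 0) →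
    (∀ s, HasDerivAt F (F' s) s) → (∀ s, HasDerivAt F' (F'' s) s) → ContDiff ℝ 1 F' → Continuous F'' →
      ∫ q in Ioc 0 L ×ˢ univ, F' (vorticity u v q.1 q.2) * ψ q.2 * (dX b q.1 q.2 - dY a q.1 q.2) =
        (∫ q in Ioc 0 L ×ˢ univ,
            (vorticity u v q.1 q.2 * F' (vorticity u v q.1 q.2) - F (vorticity u v q.1 q.2)) * ψ q.2) +
          (∫ q in Ioc 0 L ×ˢ univ, F (vorticity u v q.1 q.2) * (v q.1 q.2 - q.2) * deriv ψ q.2) -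
          ν * (∫ q in Ioc 0 L ×ˢ univ, F'' (vorticity u v q.1 q.2) *
            (dX (vorticity u v) q.1 q.2 ^ 2 + dY (vorticity u v) q.1 q.2 ^ 2) * ψ q.2) -
          ν * ∫ q in Ioc 0 L ×ˢ univ,
            F' (vorticity u v q.1 q.2) * dY (vorticity u v) q.1 q.2 * deriv ψ q.2 := by
  intro L ν R u v p a b ψ F F' F'' hL hu hv hp ha hb hmx hmy hdiv huper hvper hpper hbper hψ hψR hF hF' hF'1 hF''c
  set ω : ℝ → ℝ → ℝ := vorticity u v with hωdef
  set Φ : ℝ → ℝ → ℝ := fun x y => F' (ω x y) * ψ y with hΦdef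
  -- regularity
  have hu1 : ContDiff ℝ 1 (fun q : ℝ × ℝ => u q.1 q.2) := hu.of_le one_le_two
  have hv1 : ContDiff ℝ 1 (fun q : ℝ × ℝ => v q.1 q.2) := hv.of_le one_le_two
  have hω1 : ContDiff ℝ 1 (fun q : ℝ × ℝ => ω q.1 q.2) := contDiff_one_vorticity hu hv
  have hΦ1 : ContDiff ℝ 1 (fun q : ℝ × ℝ => Φ q.1 q.2) := (hF'1.comp hω1).mul (hψ.comp contDiff_snd)
  have cF : Continuous F := continuous_iff_continuousAt.2 fun s => (hF s).continuousAt
  have cF' : Continuous F' := hF'1.continuous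
  have cψ : Continuous ψ := hψ.continuous
  have cψ' : Continuous (deriv ψ) := hψ.continuous_deriv le_rfl
  have cu : Continuous fun q : ℝ × ℝ => u q.1 q.2 := hu.continuous
  have cv : Continuous fun q : ℝ × ℝ => v q.1 q.2 := hv.continuous
  have cux : Continuous fun q : ℝ × ℝ => dX u q.1 q.2 := continuous_dX hu1
  have cvy : Continuous fun q : ℝ × ℝ => dY v q.1 q.2 := continuous_dY hv1
  have cω : Continuous fun q : ℝ × ℝ => ω q.1 q.2 := hω1.continuous
  have cωx : Continuous fun q : ℝ × ℝ => dX ω q.1 q.2 := continuous_dX hω1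
  have cωy : Continuous fun q : ℝ × ℝ => dY ω q.1 q.2 := continuous_dY hω1
  have cFω : Continuous fun q : ℝ × ℝ => F (ω q.1 q.2) := cF.comp cω
  have cF'ω : Continuous fun q : ℝ × ℝ => F' (ω q.1 q.2) := cF'.comp cω
  have cF''ω : Continuous fun q : ℝ × ℝ => F'' (ω q.1 q.2) := hF''c.comp cω
  -- periodicity and support of the test function
  have hωper : ∀ x y, ω (x + L) y = ω x y := fun x y => by
    simp only [hωdef, StrainWorkSumRule.vorticity]; rw [dX_periodic hvper, dY_periodic huper]
  have hΦper : ∀ x y, Φ (x + L) y = Φ x y := fun x y => by simp only [hΦdef, hωper]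
  have hΦ0 : ∀ x y, R ≤ |y| → Φ x y = 0 := fun x y hy => by simp only [hΦdef, hψR y hy, mul_zero]
  have hψ'0 : ∀ y, R + 1 ≤ |y| → deriv ψ y = 0 := fun y hy =>
    kato_dY_eq_zero (Φ := fun _ s => ψ s) (x := (0:ℝ)) (fun _ s hs => hψR s hs) hy
  -- the slice derivatives of `Φ` and of `G(ω)`, `G = sF′ − F`
  have hωx : ∀ x y, HasDerivAt (fun s => ω s y) (dX ω x y) x := hasDerivAt_dX_of_contDiff hω1 one_ne_zero
  have hωy : ∀ x y, HasDerivAt (fun s => ω x s) (dY ω x y) y := hasDerivAt_dY_of_contDiff hω1 one_ne_zero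
  have hψd : ∀ y, HasDerivAt ψ (deriv ψ y) y := fun y => (hψ.differentiable one_ne_zero y).hasDerivAt
  have hΦx : ∀ x y, dX Φ x y = F'' (ω x y) * dX ω x y * ψ y := fun x y => by
    have h := (HasDerivAt.comp (h₂ := F') (h := fun s => ω s y) x (hF' (ω x y)) (hωx x y)).mul_const (ψ y)
    exact h.deriv
  have hΦy : ∀ x y, dY Φ x y = F'' (ω x y) * dY ω x y * ψ y + F' (ω x y) * deriv ψ y := fun x y => by
    have h := (HasDerivAt.comp (h₂ := F') (h := fun s => ω x s) y (hF' (ω x y)) (hωy x y)).mul (hψd y)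
    exact h.deriv
  have hGd : ∀ s, HasDerivAt (fun s => s * F' s - F s) (s * F'' s) s := fun s => by
    have h := ((hasDerivAt_id' s).mul (hF' s)).sub (hF s)
    refine h.congr_deriv ?_
    ring
  have hGx : ∀ x y, HasDerivAt (fun s => ω s y * F' (ω s y) - F (ω s y)) (ω x y * F'' (ω x y) * dX ω x y) x :=
    fun x y => HasDerivAt.comp (h₂ := fun s => s * F' s - F s) (h := fun s => ω s y) x (hGd (ω x y)) (hωx x y)
  have hGy : ∀ x y, HasDerivAt (fun s => ω x s * F' (ω x s) - F (ω x s)) (ω x y * F'' (ω x y) * dY ω x y) y :=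
    fun x y => HasDerivAt.comp (h₂ := fun s => s * F' s - F s) (h := fun s => ω x s) y (hGd (ω x y)) (hωy x y)
  -- the weak vorticity balance tested against `Φ`
  have key := stub_vorticityUniformBounds_weakVorticity L ν R u v p a b Φ hL hu hv hp ha hb hΦ1 hmx hmy hdiv
    huper hvper hpper hbper hΦper hΦ0
  rw [show (fun q : ℝ × ℝ => F' (vorticity u v q.1 q.2) * ψ q.2 * (dX b q.1 q.2 - dY a q.1 q.2)) =
    fun q : ℝ × ℝ => Φ q.1 q.2 * (dX b q.1 q.2 - dY a q.1 q.2) from rfl, key]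
  -- integrability helpers: a factor `ψ` or `ψ′`
  have hIψ : ∀ G : ℝ × ℝ → ℝ, Continuous G →
      IntegrableOn (fun q : ℝ × ℝ => G q * ψ q.2) (Ioc 0 L ×ˢ univ) := fun G hG =>
    kato_integrableOn_strip_of_eq_zero (R := R) (hG.mul (cψ.comp continuous_snd)) fun x _ y hy => by
      simp only [hψR y hy, mul_zero]
  have hIψ' : ∀ G : ℝ × ℝ → ℝ, Continuous G →
      IntegrableOn (fun q : ℝ × ℝ => G q * deriv ψ q.2) (Ioc 0 L ×ˢ univ) := fun G hG =>
    kato_integrableOn_strip_of_eq_zero (R := R + 1) (hG.mul (cψ'.comp continuous_snd)) fun x _ y hy => by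
      simp only [hψ'0 y hy, mul_zero]
  have hS : MeasurableSet (Ioc (0:ℝ) L ×ˢ (univ : Set ℝ)) := measurableSet_Ioc.prod MeasurableSet.univ
  ------------------------------------------------------------------
  -- the transport part: `∫∫ ω(uΦₓ + (v−y)Φ_y) = ∫∫ G(ω)ψ + ∫∫ F(ω)(v−y)ψ′`
  ------------------------------------------------------------------
  have hT : ∫ q in Ioc 0 L ×ˢ univ, ω q.1 q.2 * (u q.1 q.2 * dX Φ q.1 q.2 + (v q.1 q.2 - q.2) * dY Φ q.1 q.2) =
      (∫ q in Ioc 0 L ×ˢ univ, (ω q.1 q.2 * F' (ω q.1 q.2) - F (ω q.1 q.2)) * ψ q.2) +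
        ∫ q in Ioc 0 L ×ˢ univ, F (ω q.1 q.2) * (v q.1 q.2 - q.2) * deriv ψ q.2 := by
    -- integration by parts in `x`
    have ibx : ∫ q in Ioc 0 L ×ˢ univ, (u q.1 q.2 * ψ q.2) * (ω q.1 q.2 * F'' (ω q.1 q.2) * dX ω q.1 q.2) =
        -∫ q in Ioc 0 L ×ˢ univ, (dX u q.1 q.2 * ψ q.2) * (ω q.1 q.2 * F' (ω q.1 q.2) - F (ω q.1 q.2)) := by
      refine integral_strip_mul_dX_eq_neg hL.le (f := fun x y => u x y * ψ y)
        (g := fun x y => ω x y * F' (ω x y) - F (ω x y))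
        (f' := fun x y => dX u x y * ψ y) (g' := fun x y => ω x y * F'' (ω x y) * dX ω x y)
        (fun x y => (hasDerivAt_dX_of_contDiff hu two_ne_zero x y).mul_const (ψ y)) hGx
        (fun y => by fun_prop) (fun y => by fun_prop) (fun y => ?_) ?_ ?_
      · have h1 := huper 0 y; have h2 := hωper 0 y
        rw [zero_add] at h1 h2
        rw [h1, h2]
      · have := hIψ (fun q => u q.1 q.2 * (ω q.1 q.2 * F'' (ω q.1 q.2) * dX ω q.1 q.2)) (by fun_prop)
        exact this.congr_fun (fun q _ => by simp only; ring) hS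
      · have := hIψ (fun q => dX u q.1 q.2 * (ω q.1 q.2 * F' (ω q.1 q.2) - F (ω q.1 q.2))) (by fun_prop)
        exact this.congr_fun (fun q _ => by simp only; ring) hS
    -- integration by parts in `y`
    have iby : ∫ q in Ioc 0 L ×ˢ univ, ((v q.1 q.2 - q.2) * ψ q.2) * (ω q.1 q.2 * F'' (ω q.1 q.2) * dY ω q.1 q.2) =
        -∫ q in Ioc 0 L ×ˢ univ, ((dY v q.1 q.2 - 1) * ψ q.2 + (v q.1 q.2 - q.2) * deriv ψ q.2) *
          (ω q.1 q.2 * F' (ω q.1 q.2) - F (ω q.1 q.2)) := by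
      refine integral_strip_mul_dY_eq_neg (f := fun x y => (v x y - y) * ψ y)
        (g := fun x y => ω x y * F' (ω x y) - F (ω x y))
        (f' := fun x y => (dY v x y - 1) * ψ y + (v x y - y) * deriv ψ y)
        (g' := fun x y => ω x y * F'' (ω x y) * dY ω x y)
        (fun x y => ((hasDerivAt_dY_of_contDiff hv two_ne_zero x y).sub (hasDerivAt_id y)).mul (hψd y))
        hGy ?_ ?_ ?_
      · have := hIψ (fun q => (v q.1 q.2 - q.2) * (ω q.1 q.2 * F'' (ω q.1 q.2) * dY ω q.1 q.2)) (by fun_prop)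
        exact this.congr_fun (fun q _ => by simp only; ring) hS
      · have h1 := hIψ (fun q => (dY v q.1 q.2 - 1) * (ω q.1 q.2 * F' (ω q.1 q.2) - F (ω q.1 q.2))) (by fun_prop)
        have h2 := hIψ' (fun q => (v q.1 q.2 - q.2) * (ω q.1 q.2 * F' (ω q.1 q.2) - F (ω q.1 q.2))) (by fun_prop)
        have h12 : IntegrableOn (fun q : ℝ × ℝ =>
            (dY v q.1 q.2 - 1) * (ω q.1 q.2 * F' (ω q.1 q.2) - F (ω q.1 q.2)) * ψ q.2 +
            (v q.1 q.2 - q.2) * (ω q.1 q.2 * F' (ω q.1 q.2) - F (ω q.1 q.2)) * deriv ψ q.2) (Ioc 0 L ×ˢ univ) :=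
          h1.add h2
        exact h12.congr_fun (fun q _ => by simp only; ring) hS
      · have := hIψ (fun q => (v q.1 q.2 - q.2) * (ω q.1 q.2 * F' (ω q.1 q.2) - F (ω q.1 q.2))) (by fun_prop)
        exact this.congr_fun (fun q _ => by simp only; ring) hS
    -- integrability of the pieces
    have iA : IntegrableOn (fun q : ℝ × ℝ => (u q.1 q.2 * ψ q.2) * (ω q.1 q.2 * F'' (ω q.1 q.2) * dX ω q.1 q.2))
        (Ioc 0 L ×ˢ univ) := by
      have := hIψ (fun q => u q.1 q.2 * (ω q.1 q.2 * F'' (ω q.1 q.2) * dX ω q.1 q.2)) (by fun_prop)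
      exact this.congr_fun (fun q _ => by simp only; ring) hS
    have iB : IntegrableOn (fun q : ℝ × ℝ => ((v q.1 q.2 - q.2) * ψ q.2) *
        (ω q.1 q.2 * F'' (ω q.1 q.2) * dY ω q.1 q.2)) (Ioc 0 L ×ˢ univ) := by
      have := hIψ (fun q => (v q.1 q.2 - q.2) * (ω q.1 q.2 * F'' (ω q.1 q.2) * dY ω q.1 q.2)) (by fun_prop)
      exact this.congr_fun (fun q _ => by simp only; ring) hS
    have iC : IntegrableOn (fun q : ℝ × ℝ => ω q.1 q.2 * F' (ω q.1 q.2) * (v q.1 q.2 - q.2) * deriv ψ q.2)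
        (Ioc 0 L ×ˢ univ) := hIψ' (fun q => ω q.1 q.2 * F' (ω q.1 q.2) * (v q.1 q.2 - q.2)) (by fun_prop)
    have iD : IntegrableOn (fun q : ℝ × ℝ => (dX u q.1 q.2 * ψ q.2) * (ω q.1 q.2 * F' (ω q.1 q.2) - F (ω q.1 q.2)))
        (Ioc 0 L ×ˢ univ) := by
      have := hIψ (fun q => dX u q.1 q.2 * (ω q.1 q.2 * F' (ω q.1 q.2) - F (ω q.1 q.2))) (by fun_prop)
      exact this.congr_fun (fun q _ => by simp only; ring) hS
    have iE : IntegrableOn (fun q : ℝ × ℝ => ((dY v q.1 q.2 - 1) * ψ q.2 + (v q.1 q.2 - q.2) * deriv ψ q.2) *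
        (ω q.1 q.2 * F' (ω q.1 q.2) - F (ω q.1 q.2))) (Ioc 0 L ×ˢ univ) := by
      have h1 := hIψ (fun q => (dY v q.1 q.2 - 1) * (ω q.1 q.2 * F' (ω q.1 q.2) - F (ω q.1 q.2))) (by fun_prop)
      have h2 := hIψ' (fun q => (v q.1 q.2 - q.2) * (ω q.1 q.2 * F' (ω q.1 q.2) - F (ω q.1 q.2))) (by fun_prop)
      have h12 : IntegrableOn (fun q : ℝ × ℝ =>
          (dY v q.1 q.2 - 1) * (ω q.1 q.2 * F' (ω q.1 q.2) - F (ω q.1 q.2)) * ψ q.2 +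
          (v q.1 q.2 - q.2) * (ω q.1 q.2 * F' (ω q.1 q.2) - F (ω q.1 q.2)) * deriv ψ q.2) (Ioc 0 L ×ˢ univ) :=
        h1.add h2
      exact h12.congr_fun (fun q _ => by simp only; ring) hS
    have iP : IntegrableOn (fun q : ℝ × ℝ => (ω q.1 q.2 * F' (ω q.1 q.2) - F (ω q.1 q.2)) * ψ q.2)
        (Ioc 0 L ×ˢ univ) := hIψ (fun q => ω q.1 q.2 * F' (ω q.1 q.2) - F (ω q.1 q.2)) (by fun_prop)
    have iQ : IntegrableOn (fun q : ℝ × ℝ => F (ω q.1 q.2) * (v q.1 q.2 - q.2) * deriv ψ q.2) (Ioc 0 L ×ˢ univ) :=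
      hIψ' (fun q => F (ω q.1 q.2) * (v q.1 q.2 - q.2)) (by fun_prop)
    -- split the transport integrand
    have e1 : ∫ q in Ioc 0 L ×ˢ univ, ω q.1 q.2 * (u q.1 q.2 * dX Φ q.1 q.2 + (v q.1 q.2 - q.2) * dY Φ q.1 q.2) =
        (∫ q in Ioc 0 L ×ˢ univ, (u q.1 q.2 * ψ q.2) * (ω q.1 q.2 * F'' (ω q.1 q.2) * dX ω q.1 q.2)) +
        (∫ q in Ioc 0 L ×ˢ univ, ((v q.1 q.2 - q.2) * ψ q.2) * (ω q.1 q.2 * F'' (ω q.1 q.2) * dY ω q.1 q.2)) +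
        ∫ q in Ioc 0 L ×ˢ univ, ω q.1 q.2 * F' (ω q.1 q.2) * (v q.1 q.2 - q.2) * deriv ψ q.2 := by
      have iAB : IntegrableOn (fun q : ℝ × ℝ => (u q.1 q.2 * ψ q.2) * (ω q.1 q.2 * F'' (ω q.1 q.2) * dX ω q.1 q.2) +
          ((v q.1 q.2 - q.2) * ψ q.2) * (ω q.1 q.2 * F'' (ω q.1 q.2) * dY ω q.1 q.2)) (Ioc 0 L ×ˢ univ) :=
        iA.add iB
      rw [← integral_add iA iB, ← integral_add iAB iC]
      refine integral_congr_ae (Eventually.of_forall fun q => ?_)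
      simp only
      rw [hΦx, hΦy]
      ring
    have e2 : (-∫ q in Ioc 0 L ×ˢ univ, (dX u q.1 q.2 * ψ q.2) * (ω q.1 q.2 * F' (ω q.1 q.2) - F (ω q.1 q.2))) +
        (-∫ q in Ioc 0 L ×ˢ univ, ((dY v q.1 q.2 - 1) * ψ q.2 + (v q.1 q.2 - q.2) * deriv ψ q.2) *
          (ω q.1 q.2 * F' (ω q.1 q.2) - F (ω q.1 q.2))) +
        (∫ q in Ioc 0 L ×ˢ univ, ω q.1 q.2 * F' (ω q.1 q.2) * (v q.1 q.2 - q.2) * deriv ψ q.2) =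
        (∫ q in Ioc 0 L ×ˢ univ, (ω q.1 q.2 * F' (ω q.1 q.2) - F (ω q.1 q.2)) * ψ q.2) +
          ∫ q in Ioc 0 L ×ˢ univ, F (ω q.1 q.2) * (v q.1 q.2 - q.2) * deriv ψ q.2 := by
      have iDn : IntegrableOn (fun q : ℝ × ℝ =>
          -((dX u q.1 q.2 * ψ q.2) * (ω q.1 q.2 * F' (ω q.1 q.2) - F (ω q.1 q.2)))) (Ioc 0 L ×ˢ univ) := iD.neg
      have iEn : IntegrableOn (fun q : ℝ × ℝ =>
          -(((dY v q.1 q.2 - 1) * ψ q.2 + (v q.1 q.2 - q.2) * deriv ψ q.2) *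
            (ω q.1 q.2 * F' (ω q.1 q.2) - F (ω q.1 q.2)))) (Ioc 0 L ×ˢ univ) := iE.neg
      have iDE : IntegrableOn (fun q : ℝ × ℝ =>
          -((dX u q.1 q.2 * ψ q.2) * (ω q.1 q.2 * F' (ω q.1 q.2) - F (ω q.1 q.2))) +
          -(((dY v q.1 q.2 - 1) * ψ q.2 + (v q.1 q.2 - q.2) * deriv ψ q.2) *
            (ω q.1 q.2 * F' (ω q.1 q.2) - F (ω q.1 q.2)))) (Ioc 0 L ×ˢ univ) := iDn.add iEn
      rw [← integral_neg, ← integral_neg, ← integral_add iDn iEn, ← integral_add iDE iC, ← integral_add iP iQ]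
      refine integral_congr_ae (Eventually.of_forall fun q => ?_)
      simp only
      have h1 : dY v q.1 q.2 = -dX u q.1 q.2 := by linarith [hdiv q.1 q.2]
      rw [h1]
      ring
    rw [e1, ibx, iby]
    exact e2
  ------------------------------------------------------------------
  -- the viscous part
  ------------------------------------------------------------------
  have hV : ∫ q in Ioc 0 L ×ˢ univ, (dX ω q.1 q.2 * dX Φ q.1 q.2 + dY ω q.1 q.2 * dY Φ q.1 q.2) =
      (∫ q in Ioc 0 L ×ˢ univ, F'' (ω q.1 q.2) * (dX ω q.1 q.2 ^ 2 + dY ω q.1 q.2 ^ 2) * ψ q.2) +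
        ∫ q in Ioc 0 L ×ˢ univ, F' (ω q.1 q.2) * dY ω q.1 q.2 * deriv ψ q.2 := by
    rw [← integral_add (hIψ _ (by fun_prop)) (hIψ' _ (by fun_prop))]
    refine integral_congr_ae (Eventually.of_forall fun q => ?_)
    simp only
    rw [hΦx, hΦy]
    ring
  rw [hT, hV]
  ring

end Static

end Summit.AnomalousDissipation.AnomalousDissipation.Theorems.StrainedLayerLaw.LogEnstrophyClock

end
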